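import Summits.RiemannHypothesis.RiemannHypothesis.Theorems.WeilWindowFlowGronwallLeakageCalibration
import Summits.RiemannHypothesis.RiemannHypothesis.Theorems.WeilWindowFlowWindowLipschitz
import Literature.Analysis.FluidPDE.IntegratedChainRule
import HarnessLib

/-!
# `GronwallLeakage ↔ RiemannHypothesis` (crux stmt-RiemannHypothesis-1037, route WeilWindowFlow)

The crux `X = GronwallLeakage` (Grönwall leakage law for the window bottom `ε = weilGroundEnergy` of Weil's
quadratic form) is EQUIVALENT to the Riemann hypothesis. Assembly of landed tree theorems only:

* `gronwallLeakage_iff_riemannHypothesis_and_logAC` (Calibration, p88152): `X ⟺ RH ∧ LogAC`, where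
  `LogAC := ∀ 0 < b ≤ a, AbsolutelyContinuousOnInterval (log ∘ ε) b a` — from the structure theorem
  `gronwallLeakage_iff_pos_and_logAC` (refuter, `Theorems/GronwallLeakage/Negative/Structure.lean`), Yoshida's
  criterion and `strictUnderRH_proof`;
* `WindowLipschitz_proof` (crux stmt-RiemannHypothesis-1039, closed 2026-08-16): `ε` is Lipschitz on every
  `[b₀, A] ⊂ (0, ∞)` (one-sided bound + antitonicity), hence absolutely continuous there
  (`weilGroundEnergy_absolutelyContinuousOnInterval`, unconditional);
* under `StrictPos` (⟸ RH), `log` is Lipschitz on `[ε a, ∞) ∋ ε x` for `x ∈ [b, a]`, so `LogAC` holds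
  (`logAC_of_strictPos`); therefore `RH → LogAC` and `X ⟺ RH` (`gronwallLeakage_iff_riemannHypothesis`).

Consequence for the route: thesis X of WeilWindowFlow is now a proved REFORMULATION of RH — its regularity content
(`WindowLipschitz`, `WindowContinuity`, the AC of `log ε` under strict positivity) is discharged, and what remains of
the crux is `StrictPos ⟺ RH` itself (line `Sketch`, stub `stub_strictPos`).

Axioms ⊆ {propext, Classical.choice, Quot.sound}.
-/

-- `Summit.RiemannHypothesis.RiemannHypothesis.…` repeats a namespace component by design (D-0017 layout).
set_option linter.dupNamespace false

noncomputable section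

open MeasureTheory Set Filter
open scoped Topology NNReal

namespace Summit.RiemannHypothesis.RiemannHypothesis.Theorems.WeilWindowFlowGronwallLeakage

open Literature.NumberTheory.LFunctions
open Summit.RiemannHypothesis.RiemannHypothesis.Theses.WeilWindowFlow
open Summit.RiemannHypothesis.Cruxes.GronwallLeakage.Negative
open Summit.RiemannHypothesis.RiemannHypothesis.Theorems.WeilWindowFlowWindowLipschitz (WindowLipschitz_proof)

/-- **`ε` is absolutely continuous on every compact window range** `[b, a] ⊂ (0, ∞)` — unconditional.
From `WindowLipschitz_proof` (crux 1039): `ε x - ε y ≤ L (y - x)` for `b ≤ x ≤ y ≤ a`, and `0 ≤ ε x - ε y`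
by antitonicity, so `ε` is `max L 0`-Lipschitz on `[b, a]`, hence absolutely continuous
(`LipschitzOnWith.absolutelyContinuousOnInterval`). [folklore] -/
theorem weilGroundEnergy_absolutelyContinuousOnInterval {b a : ℝ} (hb : 0 < b) (hba : b ≤ a) :
    AbsolutelyContinuousOnInterval weilGroundEnergy b a := by
  obtain ⟨L, hL⟩ := WindowLipschitz_proof b a hb hba
  have key : ∀ x y : ℝ, b ≤ x → x ≤ y → y ≤ a →
      dist (weilGroundEnergy x) (weilGroundEnergy y) ≤ max L 0 * dist x y := by
    intro x y hx hxy hy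
    have h1 : weilGroundEnergy x - weilGroundEnergy y ≤ L * (y - x) := hL x y hx hxy hy
    have h2 : 0 ≤ weilGroundEnergy x - weilGroundEnergy y :=
      sub_nonneg.2 (weilGroundEnergy_antitone_of_pos' (hb.trans_le hx) hxy)
    have h3 : L * (y - x) ≤ max L 0 * (y - x) :=
      mul_le_mul_of_nonneg_right (le_max_left _ _) (sub_nonneg.2 hxy)
    rw [Real.dist_eq, Real.dist_eq, abs_of_nonneg h2, abs_sub_comm, abs_of_nonneg (sub_nonneg.2 hxy)]
    exact h1.trans h3
  have hlip : LipschitzOnWith (Real.toNNReal (max L 0)) weilGroundEnergy (uIcc b a) := by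
    refine LipschitzOnWith.of_dist_le_mul fun x hx y hy ↦ ?_
    rw [uIcc_of_le hba] at hx hy
    rw [Real.coe_toNNReal _ (le_max_right _ _)]
    rcases le_total x y with hxy | hyx
    · exact key x y hx.1 hxy hy.2
    · rw [dist_comm, dist_comm x]
      exact key y x hy.1 hyx hx.2
  exact hlip.absolutelyContinuousOnInterval

/-- `log` is `η⁻¹`-Lipschitz on `[η, ∞)` for `η > 0`, as a `dist` inequality. [folklore] -/
theorem dist_log_le_inv_mul_dist {η x y : ℝ} (hη : 0 < η) (hx : η ≤ x) (hy : η ≤ y) :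
    dist (Real.log x) (Real.log y) ≤ η⁻¹ * dist x y := by
  have hx0 : 0 < x := hη.trans_le hx
  have hy0 : 0 < y := hη.trans_le hy
  -- one-sided bound `log u - log v ≤ (u - v) / v ≤ |u - v| / η`
  have key : ∀ u v : ℝ, 0 < u → η ≤ v → Real.log u - Real.log v ≤ η⁻¹ * |u - v| := by
    intro u v hu hv
    have hv0 : 0 < v := hη.trans_le hv
    have h1 : Real.log u - Real.log v = Real.log (u / v) := (Real.log_div hu.ne' hv0.ne').symm
    have h2 : Real.log (u / v) ≤ u / v - 1 := Real.log_le_sub_one_of_pos (div_pos hu hv0)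
    have h3 : u / v - 1 = (u - v) / v := by field_simp
    have h4 : (u - v) / v ≤ |u - v| / η := by
      rw [div_le_div_iff₀ hv0 hη]
      calc (u - v) * η ≤ |u - v| * η := by gcongr; exact le_abs_self _
        _ ≤ |u - v| * v := by gcongr
    calc Real.log u - Real.log v = Real.log (u / v) := h1
      _ ≤ (u - v) / v := by rw [← h3]; exact h2
      _ ≤ |u - v| / η := h4
      _ = η⁻¹ * |u - v| := by rw [div_eq_inv_mul]
  rw [Real.dist_eq, Real.dist_eq, abs_sub_le_iff]
  constructor
  · exact key x y hx0 hy
  · simpa [abs_sub_comm] using key y x hy0 hx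

/-- **`StrictPos → LogAC`** (unconditional implication): if the window bottom is strictly positive at every window,
then `log ε` is absolutely continuous on every `[b, a] ⊂ (0, ∞)` — `ε` is absolutely continuous there
(`weilGroundEnergy_absolutelyContinuousOnInterval`) with values in `[ε a, ∞)` (antitone), where `log` is
Lipschitz. [folklore] -/
theorem logAC_of_strictPos (hpos : ∀ a : ℝ, 0 < a → 0 < weilGroundEnergy a) :
    ∀ b a : ℝ, 0 < b → b ≤ a →
      AbsolutelyContinuousOnInterval (fun x ↦ Real.log (weilGroundEnergy x)) b a := by
  intro b a hb hba
  have hεa : 0 < weilGroundEnergy a := hpos a (hb.trans_le hba)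
  have hlip : LipschitzOnWith (Real.toNNReal (weilGroundEnergy a)⁻¹) Real.log
      (Ici (weilGroundEnergy a)) := by
    refine LipschitzOnWith.of_dist_le_mul fun x hx y hy ↦ ?_
    rw [Real.coe_toNNReal _ (inv_nonneg.2 hεa.le)]
    exact dist_log_le_inv_mul_dist hεa hx hy
  have hmaps : MapsTo weilGroundEnergy (uIcc b a) (Ici (weilGroundEnergy a)) := by
    intro x hx
    rw [uIcc_of_le hba] at hx
    exact weilGroundEnergy_antitone_of_pos' (hb.trans_le hx.1) hx.2
  exact (weilGroundEnergy_absolutelyContinuousOnInterval hb hba).comp_of_lipschitzOnWith hlip hmaps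

/-- **The crux is the Riemann hypothesis.** `GronwallLeakage ↔ RiemannHypothesis`: `→` is the route's deciding
theorem (`closes`, via `gronwallLeakage_iff_riemannHypothesis_and_logAC`); `←`: RH gives `StrictPos`
(`strictPos_iff_riemannHypothesis`, i.e. `strictUnderRH_proof`) and then `LogAC` unconditionally
(`logAC_of_strictPos`, from `WindowLipschitz_proof`). [folklore] -/
theorem gronwallLeakage_iff_riemannHypothesis : GronwallLeakage ↔ _root_.RiemannHypothesis := by
  rw [gronwallLeakage_iff_riemannHypothesis_and_logAC]
  exact ⟨And.left, fun hRH ↦ ⟨hRH, logAC_of_strictPos (strictPos_iff_riemannHypothesis.2 hRH)⟩⟩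

/-- The same with the summit statement `Summit.RiemannHypothesis` (`= _root_.RiemannHypothesis` by
`Summit.RiemannHypothesis_iff`). [folklore] -/
theorem gronwallLeakage_iff_summit : GronwallLeakage ↔ _root_.Summit.RiemannHypothesis :=
  gronwallLeakage_iff_riemannHypothesis.trans (_root_.Summit.RiemannHypothesis_iff).symm

end Summit.RiemannHypothesis.RiemannHypothesis.Theorems.WeilWindowFlowGronwallLeakage

end
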